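import Summits.QuantumFields.QCD.Theses.HeatSlicedQuarks
import Summits.QuantumFields.QCD.Theses.GradientFlowSpecies
import Summits.QuantumFields.QCD.Theorems.RobustYangMillsHandover.Negative.ChiralityObstruction

/-!
# `RobustYangMillsHandover` — the PINNED threshold reading of the re-typed conjunct
# (definition-free; line `lee-yang-mass-handover`, lead a2, 2026-08-16)

Crux `stmt-QuantumFields-8892` of route `HeatSlicedQuarks` is the bare arrow
`RobustYangMillsHandover := ContinuumQCDExists → QCD`.  Before the statement re-type p117723 every line
on it ended with the threshold reading `qcdOf_iff_threshold : QCDOf N_f ↔ ∃ M₀ ≥ 0, ∃ reg, … ∀ m > M₀ …`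
(shift `m_crit` by an ARBITRARY threshold); the re-type (`QCDOf` conjoins `reg.IsChiralAtZero`) made that
head a non-theorem and all twelve round-1 lines died at it
(`Negative.ChiralityObstruction.not_isChiralAtZero_mcrit_shift_of_uniformGapAbove`).

This file records the REPAIRED reading, kernel-checked and importable (route module + the def-free
`Negative.ChiralityObstruction` only):

* `qcdOf_iff_pinnedThreshold` — **`QCDOf N_f` holds iff some mass-scaling regularisation `reg` and some
  offset `P` satisfy: (χ) the lattice rate is NOT uniform just above `P`
  (`∀ ε > 0, ∃ t > P, ¬ HasLatticeMassGap ε`), and (D) every offset tuple above `P` carries honest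
  continuum data with the three non-triviality clauses, a continuum gap and a lattice gap.**  The witness
  is the `m_crit`-shift by `P`; (χ) is exactly chirality of the shifted regularisation
  (`isChiralAtZero_shift_iff_noUniformRate`).  So a threshold `M₀` closes the conjunct iff it is PINNED
  at an offset where the rate is not uniform from above — the chiral point — never at an arbitrary one.
* `exists_pin` — **where such a `P` comes from**: if the set of offsets above which every tuple is
  lattice-gapped is non-empty (the heavy-threshold half, item 8922's shape), some tuple is not
  lattice-gapped (Goldstone input I), and a uniformly gapped half-line of offsets is open from below
  (`OpensBelow`, Goldstone input II / "no uniform-gap first-order endpoint on the quark-mass axis"), then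
  the infimum `P` of that set has every tuple above it lattice-gapped AND no uniform rate above it.
  (Pure order theory on `ℝ`; the pin of the round-2 card `pin-the-infimum`, ideator r2 k4, here def-free.)
* `robustYangMillsHandover_of_pinInputs` — the crux BY NAME from: item 8922
  `GradientFlowSpecies.MassiveLatticeGap`, Goldstone I, `OpensBelow`, and honest gapped continuum data above
  every gapped threshold of X₀'s regularisation (X₀ itself supplies the data at positive offsets; the new
  content is the continuum gap and, when the pin is negative, light-quark existence below X₀'s offset).

These are the composition and the transparency lemmas of the registered skeleton
`Cruxes/RobustYangMillsHandover/Lines/lee_yang_mass_handover.lean` with its local definitions unfolded.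
Nothing here asserts a Theses decl.
-/

namespace Summit.QuantumFields.QCD.Theorems.RobustYangMillsHandover.PinnedThreshold

open Summit.QuantumFields.QCD.Theses.HeatSlicedQuarks
open Literature.MathematicalPhysics.QuantumFieldTheory
open Filter

variable {Nf : ℕ}

/-! ## §1 Monotonicity of the lattice gap clause in the rate -/

/-- The lattice gap clause is antitone in the rate. [folklore] -/
theorem hasLatticeMassGap_of_le (sch : QCDScheme Nf) {Δ Δ' : ℝ} (hle : Δ ≤ Δ')
    (h : sch.HasLatticeMassGap Δ') : sch.HasLatticeMassGap Δ := by
  intro R R' A B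
  obtain ⟨C, hC⟩ := h R R' A B
  refine ⟨C, ?_⟩
  filter_upwards [hC] with k hk S hS n hn
  refine (hk S hS n hn).trans ?_
  have hC0 : 0 ≤ C := by
    have h1 := (norm_nonneg _).trans (hk S hS n hn)
    exact nonneg_of_mul_nonneg_left h1 (Real.exp_pos _)
  refine mul_le_mul_of_nonneg_left (Real.exp_le_exp.mpr ?_) hC0
  have : 0 ≤ sch.a k * n := mul_nonneg (sch.a_pos k).le (Nat.cast_nonneg n)
  nlinarith

/-! ## §2 The pinned threshold reading of `QCDOf` -/

/-- **Chirality of the shift by `P` IS "no uniform lattice rate just above `P`".** [folklore] -/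
theorem isChiralAtZero_shift_iff_noUniformRate (reg : QCDRegularisation Nf) (P : ℝ) :
    ({ reg with mcrit := fun k => reg.mcrit k + reg.a k * P / reg.Zm k } : QCDRegularisation Nf).IsChiralAtZero
      ↔ ∀ ε > (0 : ℝ), ∃ t : Fin Nf → ℝ, (∀ f, P < t f) ∧ ¬ (reg.scheme t 0 0).HasLatticeMassGap ε := by
  rw [Negative.isChiralAtZero_mcrit_shift_iff]
  constructor
  · intro h ε hε
    obtain ⟨m, hm, hng⟩ := h ε hε
    exact ⟨fun f => P + m f, fun f => by linarith [hm f], hng⟩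
  · intro h ε hε
    obtain ⟨t, ht, hng⟩ := h ε hε
    refine ⟨fun f => t f - P, fun f => by linarith [ht f], ?_⟩
    have ht' : (fun f => P + (t f - P)) = t := funext fun f => by ring
    rwa [ht']

/-- **`QCDOf N_f` from a pinned threshold**: a mass-scaling regularisation `reg` and an offset `P` with
(χ) no uniform lattice rate just above `P` and (D) honest continuum data, a continuum gap and a lattice gap at
every tuple above `P`, witness the re-typed conjunct through the `m_crit`-shift by `P`. [folklore] -/
theorem qcdOf_of_pinnedThreshold (reg : QCDRegularisation Nf) (hMS : reg.HasMassScaling) (P : ℝ)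
    (hχ : ∀ ε > (0 : ℝ), ∃ t : Fin Nf → ℝ, (∀ f, P < t f) ∧ ¬ (reg.scheme t 0 0).HasLatticeMassGap ε)
    (hD : ∀ t : Fin Nf → ℝ, (∀ f, P < t f) →
      ∃ (z shift : QCDField Nf → ℕ → ℝ) (T : OSData (QCDField Nf) 4),
        IsQCDAlong (reg.scheme t z shift) T ∧ T.IsNontrivial QCDField.glue ∧
          T.IsNonGaussian QCDField.glue ∧
            (∀ f g : Fin Nf, f ≠ g → T.IsNontrivial (QCDField.pseudoRe f g)) ∧
              (∃ Δ > (0 : ℝ), T.HasMassGap Δ) ∧ ∃ Δ > (0 : ℝ), (reg.scheme t 0 0).HasLatticeMassGap Δ) :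
    QCDOf Nf := by
  -- the shifted scheme at `m` is the original scheme at `P + m` (the `m_crit`-shift identity, inlined so
  -- that this file does not import the stale `GluonicCompletion.Negative.Threshold`)
  have hs : ∀ (m : Fin Nf → ℝ) (z shift : QCDField Nf → ℕ → ℝ),
      ({ reg with mcrit := fun k => reg.mcrit k + reg.a k * P / reg.Zm k } : QCDRegularisation Nf).scheme
        m z shift = reg.scheme (fun f => P + m f) z shift := by
    intro m z shift
    simp only [QCDRegularisation.scheme, QCDScheme.mk.injEq, true_and, and_true]
    funext f k
    ring
  refine ⟨{ reg with mcrit := fun k => reg.mcrit k + reg.a k * P / reg.Zm k },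
    (Negative.hasMassScaling_mcrit_shift_iff reg P).mpr hMS,
    (isChiralAtZero_shift_iff_noUniformRate reg P).mpr hχ, fun m hm => ?_⟩
  obtain ⟨z, shift, T, hA, hN, hG, hPs, ⟨Δ₁, hΔ₁, hT⟩, Δ₂, hΔ₂, hL⟩ :=
    hD (fun f => P + m f) (fun f => by linarith [hm f])
  -- continuum gap at the smaller rate `min Δ₁ Δ₂`
  have hT' : T.HasMassGap (min Δ₁ Δ₂) := by
    intro n m' k k' F G hF hG'
    obtain ⟨C, hC⟩ := hT n m' k k' F G hF hG'
    refine ⟨C, fun t ht H hH => (hC t ht H hH).trans ?_⟩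
    have hC0 : 0 ≤ C := by
      have h1 := (norm_nonneg _).trans (hC t ht H hH)
      exact nonneg_of_mul_nonneg_left h1 (Real.exp_pos _)
    exact mul_le_mul_of_nonneg_left (Real.exp_le_exp.mpr (by nlinarith [min_le_left Δ₁ Δ₂])) hC0
  refine ⟨z, shift, T, ?_, hN, hG, hPs, min Δ₁ Δ₂, lt_min hΔ₁ hΔ₂, hT', ?_⟩
  · rw [hs]; exact hA
  · rw [hs]
    exact (Negative.hasLatticeMassGap_species_irrel reg _ z shift _).mpr
      (hasLatticeMassGap_of_le _ (min_le_right _ _) hL)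

/-- **The pinned threshold reading (repair of `qcdOf_iff_threshold` for the re-typed conjunct).**
`QCDOf N_f` holds iff some mass-scaling regularisation and some offset `P` have no uniform lattice rate just
above `P` and honest gapped data at every tuple above `P`.  (`→`: `P = 0` and the conjunct's own
regularisation; `←`: `qcdOf_of_pinnedThreshold`.) [folklore] -/
theorem qcdOf_iff_pinnedThreshold : QCDOf Nf ↔
    ∃ reg : QCDRegularisation Nf, reg.HasMassScaling ∧ ∃ P : ℝ,
      (∀ ε > (0 : ℝ), ∃ t : Fin Nf → ℝ, (∀ f, P < t f) ∧ ¬ (reg.scheme t 0 0).HasLatticeMassGap ε) ∧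
      ∀ t : Fin Nf → ℝ, (∀ f, P < t f) →
        ∃ (z shift : QCDField Nf → ℕ → ℝ) (T : OSData (QCDField Nf) 4),
          IsQCDAlong (reg.scheme t z shift) T ∧ T.IsNontrivial QCDField.glue ∧
            T.IsNonGaussian QCDField.glue ∧
              (∀ f g : Fin Nf, f ≠ g → T.IsNontrivial (QCDField.pseudoRe f g)) ∧
                (∃ Δ > (0 : ℝ), T.HasMassGap Δ) ∧ ∃ Δ > (0 : ℝ), (reg.scheme t 0 0).HasLatticeMassGap Δ := by
  constructor
  · rintro ⟨reg, hMS, hχ, hall⟩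
    refine ⟨reg, hMS, 0, fun ε hε => ?_, fun t ht => ?_⟩
    · obtain ⟨m, hm, hng⟩ := hχ ε hε
      exact ⟨m, hm, hng⟩
    · obtain ⟨z, shift, T, hA, hN, hG, hPs, Δ, hΔ, hT, hL⟩ := hall t ht
      exact ⟨z, shift, T, hA, hN, hG, hPs, ⟨Δ, hΔ, hT⟩, Δ, hΔ,
        (Negative.hasLatticeMassGap_species_irrel reg t z shift Δ).mp hL⟩
  · rintro ⟨reg, hMS, P, hχ, hD⟩
    exact qcdOf_of_pinnedThreshold reg hMS P hχ hD

/-! ## §3 Where the pin sits: the infimum of the gapped offsets -/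

/-- A finite tuple of reals has a strict lower bound. [folklore] -/
theorem exists_lt_all (t : Fin Nf → ℝ) : ∃ L : ℝ, ∀ f, L < t f := by
  rcases isEmpty_or_nonempty (Fin Nf) with hE | hN
  · exact ⟨0, fun f => (hE.false f).elim⟩
  · obtain ⟨f₀, -, hf₀⟩ := Finset.exists_min_image Finset.univ t Finset.univ_nonempty
    exact ⟨t f₀ - 1, fun f => by linarith [hf₀ f (Finset.mem_univ f)]⟩

/-- A finite tuple strictly above `P` is above `P + δ` for some `δ > 0`. [folklore] -/
theorem exists_pos_add_le_all (P : ℝ) (t : Fin Nf → ℝ) (ht : ∀ f, P < t f) :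
    ∃ δ > (0 : ℝ), ∀ f, P + δ ≤ t f := by
  rcases isEmpty_or_nonempty (Fin Nf) with hE | hN
  · exact ⟨1, one_pos, fun f => (hE.false f).elim⟩
  · obtain ⟨f₀, -, hf₀⟩ := Finset.exists_min_image Finset.univ t Finset.univ_nonempty
    exact ⟨t f₀ - P, by linarith [ht f₀], fun f => by linarith [hf₀ f (Finset.mem_univ f)]⟩

/-- **The pin.**  Let `G` be the set of offsets above which every tuple of `reg` is lattice-gapped at some
rate.  If `G` is non-empty (heavy-threshold half), some tuple is not lattice-gapped (Goldstone I) and every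
uniformly gapped half-line of offsets is open from below (`OpensBelow`, Goldstone II), then `P := sInf G`
has every tuple above it lattice-gapped, NO uniform rate above it, and is minimal (every lower offset has a
non-gapped tuple above it). [folklore] -/
theorem exists_pin (reg : QCDRegularisation Nf)
    (hne : ∃ M : ℝ, ∀ t : Fin Nf → ℝ, (∀ f, M < t f) → ∃ Δ > (0 : ℝ), (reg.scheme t 0 0).HasLatticeMassGap Δ)
    (hgold : ∃ t₀ : Fin Nf → ℝ, ¬ ∃ Δ > (0 : ℝ), (reg.scheme t₀ 0 0).HasLatticeMassGap Δ)
    (hopen : ∀ M : ℝ,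
      (∃ ε > (0 : ℝ), ∀ t : Fin Nf → ℝ, (∀ f, M < t f) → (reg.scheme t 0 0).HasLatticeMassGap ε) →
        ∃ δ > (0 : ℝ), ∀ t : Fin Nf → ℝ, (∀ f, M - δ < t f) →
          ∃ Δ > (0 : ℝ), (reg.scheme t 0 0).HasLatticeMassGap Δ) :
    ∃ P : ℝ,
      (∀ t : Fin Nf → ℝ, (∀ f, P < t f) → ∃ Δ > (0 : ℝ), (reg.scheme t 0 0).HasLatticeMassGap Δ) ∧
      (∀ ε > (0 : ℝ), ∃ t : Fin Nf → ℝ, (∀ f, P < t f) ∧ ¬ (reg.scheme t 0 0).HasLatticeMassGap ε) ∧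
      ∀ P' < P, ∃ t : Fin Nf → ℝ, (∀ f, P' < t f) ∧
        ¬ ∃ Δ > (0 : ℝ), (reg.scheme t 0 0).HasLatticeMassGap Δ := by
  set G : Set ℝ := {M | ∀ t : Fin Nf → ℝ, (∀ f, M < t f) →
    ∃ Δ > (0 : ℝ), (reg.scheme t 0 0).HasLatticeMassGap Δ} with hG
  have hGne : G.Nonempty := hne
  -- Goldstone I bounds `G` below
  have hGbdd : BddBelow G := by
    obtain ⟨t₀, ht₀⟩ := hgold
    obtain ⟨L, hL⟩ := exists_lt_all t₀
    refine ⟨L, fun M hM => ?_⟩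
    by_contra hlt
    push Not at hlt
    exact ht₀ (hM t₀ fun f => lt_trans hlt (hL f))
  set P := sInf G with hP
  -- every tuple strictly above the infimum is gapped
  have habove : ∀ t : Fin Nf → ℝ, (∀ f, P < t f) →
      ∃ Δ > (0 : ℝ), (reg.scheme t 0 0).HasLatticeMassGap Δ := by
    intro t ht
    obtain ⟨δ, hδ, hδt⟩ := exists_pos_add_le_all P t ht
    obtain ⟨M, hMG, hMlt⟩ := exists_lt_of_csInf_lt hGne (show P < P + δ by linarith)
    exact hMG t fun f => by linarith [hδt f]
  refine ⟨P, habove, ?_, ?_⟩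
  · -- no uniform rate above the pin: `OpensBelow` would gap a slab below the infimum
    intro ε hε
    by_contra hcon
    push Not at hcon
    obtain ⟨δ, hδ, hslab⟩ := hopen P ⟨ε, hε, fun t ht => hcon t ht⟩
    have hmem : P - δ / 2 ∈ G := fun t ht => hslab t fun f => by linarith [ht f]
    have := csInf_le hGbdd hmem
    linarith
  · -- minimality
    intro P' hP'
    by_contra hcon
    push Not at hcon
    have hmem : P' ∈ G := fun t ht => hcon t ht
    have := csInf_le hGbdd hmem
    linarith

/-! ## §4 The crux BY NAME from the four inputs -/

/-- **`RobustYangMillsHandover` from the pin inputs.**  For the regularisation X₀ hands over at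
`N_f ∈ {2, 3}` assume: (H) the heavy-threshold lattice half (item stmt-QuantumFields-8922,
`GradientFlowSpecies.MassiveLatticeGap`, by name); (G) some offset tuple is not lattice-gapped; (O) every
uniformly gapped half-line of offsets is open from below; (D) above every offset `P` above which all tuples are
lattice-gapped, honest continuum data with the three non-triviality clauses AND a continuum gap exist (X₀'s
own data at positive offsets, the continuum gap by transfer, and light-quark existence below X₀'s offset when
`P < 0`).  Then the crux holds. [folklore] -/
theorem robustYangMillsHandover_of_pinInputs
    (hH : Summit.QuantumFields.QCD.Theses.GradientFlowSpecies.MassiveLatticeGap)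
    (hG : ∀ Nf : ℕ, Nf = 2 ∨ Nf = 3 → ∀ reg : QCDRegularisation Nf, reg.HasMassScaling →
      (∀ m : Fin Nf → ℝ, (∀ f, 0 < m f) →
        ∃ (z shift : QCDField Nf → ℕ → ℝ) (T : OSData (QCDField Nf) 4),
          IsQCDAlong (reg.scheme m z shift) T ∧ T.IsNontrivial QCDField.glue ∧
            T.IsNonGaussian QCDField.glue ∧
              ∀ f g : Fin Nf, f ≠ g → T.IsNontrivial (QCDField.pseudoRe f g)) →
      ∃ t₀ : Fin Nf → ℝ, ¬ ∃ Δ > (0 : ℝ), (reg.scheme t₀ 0 0).HasLatticeMassGap Δ)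
    (hO : ∀ Nf : ℕ, Nf = 2 ∨ Nf = 3 → ∀ reg : QCDRegularisation Nf, reg.HasMassScaling →
      (∀ m : Fin Nf → ℝ, (∀ f, 0 < m f) →
        ∃ (z shift : QCDField Nf → ℕ → ℝ) (T : OSData (QCDField Nf) 4),
          IsQCDAlong (reg.scheme m z shift) T ∧ T.IsNontrivial QCDField.glue ∧
            T.IsNonGaussian QCDField.glue ∧
              ∀ f g : Fin Nf, f ≠ g → T.IsNontrivial (QCDField.pseudoRe f g)) →
      ∀ M : ℝ,
        (∃ ε > (0 : ℝ), ∀ t : Fin Nf → ℝ, (∀ f, M < t f) → (reg.scheme t 0 0).HasLatticeMassGap ε) →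
          ∃ δ > (0 : ℝ), ∀ t : Fin Nf → ℝ, (∀ f, M - δ < t f) →
            ∃ Δ > (0 : ℝ), (reg.scheme t 0 0).HasLatticeMassGap Δ)
    (hD : ∀ Nf : ℕ, Nf = 2 ∨ Nf = 3 → ∀ reg : QCDRegularisation Nf, reg.HasMassScaling →
      (∀ m : Fin Nf → ℝ, (∀ f, 0 < m f) →
        ∃ (z shift : QCDField Nf → ℕ → ℝ) (T : OSData (QCDField Nf) 4),
          IsQCDAlong (reg.scheme m z shift) T ∧ T.IsNontrivial QCDField.glue ∧
            T.IsNonGaussian QCDField.glue ∧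
              ∀ f g : Fin Nf, f ≠ g → T.IsNontrivial (QCDField.pseudoRe f g)) →
      ∀ P : ℝ, (∀ t : Fin Nf → ℝ, (∀ f, P < t f) → ∃ Δ > (0 : ℝ), (reg.scheme t 0 0).HasLatticeMassGap Δ) →
        ∀ t : Fin Nf → ℝ, (∀ f, P < t f) →
          ∃ (z shift : QCDField Nf → ℕ → ℝ) (T : OSData (QCDField Nf) 4),
            IsQCDAlong (reg.scheme t z shift) T ∧ T.IsNontrivial QCDField.glue ∧
              T.IsNonGaussian QCDField.glue ∧
                (∀ f g : Fin Nf, f ≠ g → T.IsNontrivial (QCDField.pseudoRe f g)) ∧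
                  ∃ Δ > (0 : ℝ), T.HasMassGap Δ) :
    RobustYangMillsHandover := by
  intro hX
  have key : ∀ Nf : ℕ, Nf = 2 ∨ Nf = 3 → QCDOf Nf := by
    intro Nf hNf
    obtain ⟨reg, hMS, hdat⟩ := hX Nf hNf
    obtain ⟨P, habove, hχ, -⟩ :=
      exists_pin reg (hH Nf hNf reg ⟨hMS, hdat⟩) (hG Nf hNf reg hMS hdat) (hO Nf hNf reg hMS hdat)
    refine qcdOf_of_pinnedThreshold reg hMS P hχ fun t ht => ?_
    obtain ⟨z, shift, T, hA, hN, hGs, hPs, hTg⟩ := hD Nf hNf reg hMS hdat P habove t ht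
    exact ⟨z, shift, T, hA, hN, hGs, hPs, hTg, habove t ht⟩
  exact ⟨key 2 (Or.inl rfl), key 3 (Or.inr rfl)⟩

end Summit.QuantumFields.QCD.Theorems.RobustYangMillsHandover.PinnedThreshold
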